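/- Width seat `ym-line-cbag-p1-w2` (prover-ym-line-cbag-p1-w2-g14-0) on the planner-of-record's LINE 5, route `HankelDensitySplitting`:
helper for REGISTERED STUB B `stub_freeKernelMargin` of the birth skeleton v2 of crux `LogWindowMixedDominance` (stmt-QuantumFields-26617).
Pure real analysis; RECORD-type material (node `LatticeNonFreezing`); the Yang–Mills mass gap is NOT proved by anything here. -/
import Summits.QuantumFields.YangMills.Theorems.LogWindowMixedDominanceGreenDecayPrelims
import Literature.Probability.LatticeModels.LatticeGreenPoisson
import HarnessLib

/-!
# Pointwise bounds for the differenced mixed integrand of the `d = 4` lattice Green function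

Support file for crux `LogWindowMixedDominance` (stmt-QuantumFields-26617), stub B `FreeKernelMargin`.  For the mixed integrand
`cos(k·x) rⁿ/√(ε(ε+2))` (`r = 1 + ε − √(ε(ε+2))`, `ε = ε₃(k)`) of `LogWindowMixedDominanceGreenMixedRepr`:

* trigonometric differences `|cos(u+h) − cos u| ≤ |h|`, `|cos(u+h+h') − cos(u+h) − cos(u+h') + cos u| ≤ |h||h'|`, and the phase of a shifted
  site `k·(x + e_a) = k·x + k_a`;
* `GreenDecay.abs_setIntegral_le_one/_two`: if `|F(k)| ≤ M ‖k‖^s r(k)ⁿ` on the punctured zone (`s = 1, 2`) then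
  `|∫_{[-π,π]³} F| ≤ M · C_s / n^{s+3}` (`r ≤ e^{−(2/(3π))‖k‖}` and the cube integrals of the Prelims file);
* the four pointwise patterns `ss`, `s0`, `0ss`, `00s` (two spatial differences; one spatial + one temporal; and their temporal differences):
  bounds `(π/2)‖k‖rⁿ`, `‖k‖rⁿ`, `‖k‖²rⁿ`, `7‖k‖²rⁿ` (`|Δ_aΔ_b cos| ≤ |k_a||k_b|`, `Δ₀ rⁿ = −rⁿ(1−r)`, `(1−r)/√(ε(ε+2)) ≤ 1`, `1 − r ≤ 7‖k‖`,
  `‖k‖/√(ε(ε+2)) ≤ π/2`);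
* `integral_combo4/44`: linearity bookkeeping for four- and eight-term combinations of integrals.

[folklore]; no rung or summit statement is proved here.
-/

set_option autoImplicit false

noncomputable section

namespace Summit.QuantumFields.YangMills.Theorems.HankelDensitySplitting.LogWindow

namespace GreenDecay

open Real MeasureTheory Set Literature.Probability.LatticeModels
open Summit.QuantumFields.YangMills.Theorems.EquipartitionPinsProbe.Profile (ratio_pos ratio_le_one)

/-! ### Trigonometric differences -/

/-- `|cos(u + h) − cos u| ≤ |h|`. -/
theorem abs_cos_add_sub_cos_le (u h : ℝ) : |Real.cos (u + h) - Real.cos u| ≤ |h| := by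
  have := Real.abs_cos_sub_cos_le (u + h) u
  simpa using this

/-- `|cos(u + h + h') − cos(u + h) − cos(u + h') + cos u| ≤ |h| · |h'|` (product formula
`= −4 sin(h/2) sin(h'/2) cos(u + (h+h')/2)` and `|sin t| ≤ |t|`). -/
theorem abs_cos_second_diff_le (u h h' : ℝ) :
    |Real.cos (u + h + h') - Real.cos (u + h) - Real.cos (u + h') + Real.cos u| ≤ |h| * |h'| := by
  set v : ℝ := u + h / 2 + h' / 2 with hv
  have key : Real.cos (u + h + h') - Real.cos (u + h) - Real.cos (u + h') + Real.cos u =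
      -4 * Real.sin (h / 2) * Real.sin (h' / 2) * Real.cos v := by
    have e1 : u + h + h' = v + h / 2 + h' / 2 := by rw [hv]; ring
    have e2 : u + h = v + h / 2 - h' / 2 := by rw [hv]; ring
    have e3 : u + h' = v - h / 2 + h' / 2 := by rw [hv]; ring
    have e4 : Real.cos u = Real.cos (v - h / 2 - h' / 2) := by rw [hv]; congr 1; ring
    rw [e1, e2, e3, e4]
    simp only [Real.cos_add, Real.cos_sub, Real.sin_add, Real.sin_sub]
    ring
  rw [key]
  have h1 : |Real.sin (h / 2)| ≤ |h| / 2 := by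
    have h0 : |Real.sin (h / 2)| ≤ |h / 2| := Real.abs_sin_le_abs
    rwa [abs_div, abs_two] at h0
  have h2 : |Real.sin (h' / 2)| ≤ |h'| / 2 := by
    have h0 : |Real.sin (h' / 2)| ≤ |h' / 2| := Real.abs_sin_le_abs
    rwa [abs_div, abs_two] at h0
  have h3 : |Real.cos v| ≤ 1 := Real.abs_cos_le_one v
  rw [abs_mul, abs_mul, abs_mul, show |(-4 : ℝ)| = 4 by norm_num]
  calc 4 * |Real.sin (h / 2)| * |Real.sin (h' / 2)| * |Real.cos v|
      ≤ 4 * (|h| / 2) * (|h'| / 2) * 1 := by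
        gcongr
    _ = |h| * |h'| := by ring

/-! ### Phases of shifted sites -/

/-- `k · (x + e_a) = k · x + k_a`. -/
theorem phase_add_single (k : Fin 3 → ℝ) (x : Fin 3 → ℤ) (a : Fin 3) :
    ∑ i : Fin 3, k i * (((x + Pi.single a 1 : Fin 3 → ℤ) i : ℤ) : ℝ) = (∑ i : Fin 3, k i * (x i : ℝ)) + k a := by
  have h : ∀ i : Fin 3, k i * (((x + Pi.single a 1 : Fin 3 → ℤ) i : ℤ) : ℝ) =
      k i * (x i : ℝ) + (if i = a then k i else 0) := by
    intro i
    by_cases hi : i = a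
    · subst hi; simp [mul_add]
    · simp [hi]
  simp only [h, Finset.sum_add_distrib, Finset.sum_ite_eq', Finset.mem_univ, if_true]

/-! ### From pointwise bounds on the zone to decay in `n` -/

/-- If `|F(k)| ≤ M ‖k‖ rⁿ(k)` on the punctured zone then `|∫_{[-π,π]³} F| ≤ M · (2·12³/(2/(3π))⁴) / n⁴` (`n ≥ 1`). -/
theorem abs_setIntegral_le_one {F : (Fin 3 → ℝ) → ℝ} {M : ℝ} (hM : 0 ≤ M) {n : ℕ} (hn : 1 ≤ n)
    (hF : ∀ k ∈ brillouin 3, k ≠ 0 →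
      |F k| ≤ M * (‖k‖ * (1 + dispersion k - Real.sqrt (dispersion k * (dispersion k + 2))) ^ n)) :
    |∫ k in brillouin 3, F k| ≤ M * (2 * 12 ^ 3 / (2 / (3 * π)) ^ 4) / (n : ℝ) ^ 4 := by
  have hπ := Real.pi_pos
  have hn0 : (0 : ℝ) < n := by exact_mod_cast hn
  set a : ℝ := 2 / (3 * π) * n with ha_def
  have ha : 0 < a := by positivity
  have hg : IntegrableOn (fun k : Fin 3 → ℝ => M * (‖k‖ * Real.exp (-(a * ‖k‖)))) (brillouin 3) :=
    (Continuous.continuousOn (by fun_prop)).integrableOn_compact (isCompact_brillouin 3)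
  have hbound : ∀ᵐ k ∂(volume.restrict (brillouin 3)), ‖F k‖ ≤ M * (‖k‖ * Real.exp (-(a * ‖k‖))) := by
    filter_upwards [ae_restrict_of_ae (s := brillouin 3) (ae_ne_zero_volume_pi (d := 3) (by norm_num)),
      ae_restrict_mem (measurableSet_brillouin 3)] with k hk0 hkB
    rw [Real.norm_eq_abs]
    refine (hF k hkB hk0).trans (mul_le_mul_of_nonneg_left ?_ hM)
    refine mul_le_mul_of_nonneg_left ?_ (norm_nonneg _)
    have := ratio_pow_le_exp hkB n
    rwa [ha_def]
  have h1 := norm_integral_le_of_norm_le hg hbound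
  rw [Real.norm_eq_abs] at h1
  refine h1.trans ?_
  rw [integral_const_mul]
  have h2 := setIntegral_norm_mul_exp_le ha
  calc M * ∫ k in brillouin 3, ‖k‖ * Real.exp (-(a * ‖k‖)) ≤ M * (2 / a * (12 / a) ^ 3) :=
        mul_le_mul_of_nonneg_left h2 hM
    _ = M * (2 * 12 ^ 3 / (2 / (3 * π)) ^ 4) / (n : ℝ) ^ 4 := by
        rw [ha_def]
        field_simp

/-- If `|F(k)| ≤ M ‖k‖² rⁿ(k)` on the punctured zone then `|∫_{[-π,π]³} F| ≤ M · (16·12³/(2/(3π))⁵) / n⁵` (`n ≥ 1`). -/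
theorem abs_setIntegral_le_two {F : (Fin 3 → ℝ) → ℝ} {M : ℝ} (hM : 0 ≤ M) {n : ℕ} (hn : 1 ≤ n)
    (hF : ∀ k ∈ brillouin 3, k ≠ 0 →
      |F k| ≤ M * (‖k‖ ^ 2 * (1 + dispersion k - Real.sqrt (dispersion k * (dispersion k + 2))) ^ n)) :
    |∫ k in brillouin 3, F k| ≤ M * (16 * 12 ^ 3 / (2 / (3 * π)) ^ 5) / (n : ℝ) ^ 5 := by
  have hπ := Real.pi_pos
  have hn0 : (0 : ℝ) < n := by exact_mod_cast hn
  set a : ℝ := 2 / (3 * π) * n with ha_def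
  have ha : 0 < a := by positivity
  have hg : IntegrableOn (fun k : Fin 3 → ℝ => M * (‖k‖ ^ 2 * Real.exp (-(a * ‖k‖)))) (brillouin 3) :=
    (Continuous.continuousOn (by fun_prop)).integrableOn_compact (isCompact_brillouin 3)
  have hbound : ∀ᵐ k ∂(volume.restrict (brillouin 3)), ‖F k‖ ≤ M * (‖k‖ ^ 2 * Real.exp (-(a * ‖k‖))) := by
    filter_upwards [ae_restrict_of_ae (s := brillouin 3) (ae_ne_zero_volume_pi (d := 3) (by norm_num)),
      ae_restrict_mem (measurableSet_brillouin 3)] with k hk0 hkB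
    rw [Real.norm_eq_abs]
    refine (hF k hkB hk0).trans (mul_le_mul_of_nonneg_left ?_ hM)
    refine mul_le_mul_of_nonneg_left ?_ (sq_nonneg _)
    have := ratio_pow_le_exp hkB n
    rwa [ha_def]
  have h1 := norm_integral_le_of_norm_le hg hbound
  rw [Real.norm_eq_abs] at h1
  refine h1.trans ?_
  rw [integral_const_mul]
  have h2 := setIntegral_norm_sq_mul_exp_le ha
  calc M * ∫ k in brillouin 3, ‖k‖ ^ 2 * Real.exp (-(a * ‖k‖)) ≤ M * ((4 / a) ^ 2 * (12 / a) ^ 3) :=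
        mul_le_mul_of_nonneg_left h2 hM
    _ = M * (16 * 12 ^ 3 / (2 / (3 * π)) ^ 5) / (n : ℝ) ^ 5 := by
        rw [ha_def]
        field_simp
        norm_num

/-! ### Pointwise bounds for the weight factors -/

section Pointwise

variable {k : Fin 3 → ℝ}

/-- `‖k‖ / √(ε(ε+2)) ≤ π/2` on the punctured zone, in product form: `‖k‖ · (t/√(ε(ε+2))) ≤ (π/2) · t` for `t ≥ 0`. -/
theorem norm_mul_div_sqrt_le (hk : k ∈ brillouin 3) (hk0 : k ≠ 0) {t : ℝ} (ht : 0 ≤ t) :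
    ‖k‖ * (t / Real.sqrt (dispersion k * (dispersion k + 2))) ≤ π / 2 * t := by
  have hS := norm_le_sqrt hk
  have hε : 0 < dispersion k := dispersion_pos_of_mem_brillouin hk hk0
  have hSpos : 0 < Real.sqrt (dispersion k * (dispersion k + 2)) := Real.sqrt_pos.2 (by positivity)
  have hπ := Real.pi_pos
  rw [mul_div_assoc', div_le_iff₀ hSpos]
  have : ‖k‖ ≤ π / 2 * Real.sqrt (dispersion k * (dispersion k + 2)) := by
    rw [div_mul_eq_mul_div, le_div_iff₀ (by norm_num : (0:ℝ) < 2)]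
    have := mul_le_mul_of_nonneg_left hS (show 0 ≤ π / 2 from by positivity)
    have e : π / 2 * (2 / π * ‖k‖) = ‖k‖ := by field_simp
    nlinarith [e]
  nlinarith [mul_le_mul_of_nonneg_right this ht]

/-- `(1 − r) / √(ε(ε+2)) ≤ 1`, in product form: `(1 − r) · (t/√(ε(ε+2))) ≤ t` for `t ≥ 0` (any `k`; at `√ = 0` the left side is `0`). -/
theorem one_sub_ratio_mul_div_sqrt_le (k : Fin 3 → ℝ) {t : ℝ} (ht : 0 ≤ t) :
    (1 - (1 + dispersion k - Real.sqrt (dispersion k * (dispersion k + 2)))) *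
        (t / Real.sqrt (dispersion k * (dispersion k + 2))) ≤ t := by
  have hε0 := dispersion_nonneg k
  have h1 := one_sub_ratio_le_sqrt hε0
  have h0 := one_sub_ratio_nonneg hε0
  by_cases hS : Real.sqrt (dispersion k * (dispersion k + 2)) = 0
  · rw [hS, div_zero, mul_zero]; exact ht
  · have hSpos : 0 < Real.sqrt (dispersion k * (dispersion k + 2)) := lt_of_le_of_ne (Real.sqrt_nonneg _) (Ne.symm hS)
    rw [mul_div_assoc', div_le_iff₀ hSpos]
    exact mul_le_mul h1 le_rfl ht (Real.sqrt_nonneg _) |>.trans (by rw [mul_comm])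

end Pointwise

/-! ### Linear combinations of integrals -/

section Combos

variable {μ : Measure (Fin 3 → ℝ)} {f3 f1 f2 f0 g3 g1 g2 g0 : (Fin 3 → ℝ) → ℝ}

/-- `∫f₃ − ∫f₁ − ∫f₂ + ∫f₀ = ∫(f₃ − f₁ − f₂ + f₀)` for integrable `fᵢ`. -/
theorem integral_combo4 (h3 : Integrable f3 μ) (h1 : Integrable f1 μ) (h2 : Integrable f2 μ) (h0 : Integrable f0 μ) :
    (∫ k, f3 k ∂μ) - (∫ k, f1 k ∂μ) - (∫ k, f2 k ∂μ) + (∫ k, f0 k ∂μ) = ∫ k, (f3 k - f1 k - f2 k + f0 k) ∂μ := by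
  have h31 : Integrable (fun k => f3 k - f1 k) μ := h3.sub h1
  have h312 : Integrable (fun k => f3 k - f1 k - f2 k) μ := h31.sub h2
  rw [integral_add h312 h0, integral_sub h31 h2, integral_sub h3 h1]

/-- The difference of two such four-term combinations is one integral. -/
theorem integral_combo44 (hg3 : Integrable g3 μ) (hg1 : Integrable g1 μ) (hg2 : Integrable g2 μ) (hg0 : Integrable g0 μ)
    (h3 : Integrable f3 μ) (h1 : Integrable f1 μ) (h2 : Integrable f2 μ) (h0 : Integrable f0 μ) :
    ((∫ k, g3 k ∂μ) - (∫ k, g1 k ∂μ) - (∫ k, g2 k ∂μ) + (∫ k, g0 k ∂μ)) -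
        ((∫ k, f3 k ∂μ) - (∫ k, f1 k ∂μ) - (∫ k, f2 k ∂μ) + (∫ k, f0 k ∂μ)) =
      ∫ k, ((g3 k - g1 k - g2 k + g0 k) - (f3 k - f1 k - f2 k + f0 k)) ∂μ := by
  have hg : Integrable (fun k => g3 k - g1 k - g2 k + g0 k) μ := ((hg3.sub hg1).sub hg2).add hg0
  have hf : Integrable (fun k => f3 k - f1 k - f2 k + f0 k) μ := ((h3.sub h1).sub h2).add h0
  rw [integral_combo4 hg3 hg1 hg2 hg0, integral_combo4 h3 h1 h2 h0, ← integral_sub hg hf]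

end Combos

/-! ### Pointwise bounds for the four difference patterns -/

section Patterns

variable {k : Fin 3 → ℝ}

/-- Pattern `ss` (two spatial differences): `|Δ_αΔ_β cos(u) · rⁿ/√(ε(ε+2))| ≤ (π/2) ‖k‖ rⁿ`. -/
theorem pw_ss (hk : k ∈ brillouin 3) (hk0 : k ≠ 0) (n : ℕ) (u : ℝ) {α β : ℝ} (hα : |α| ≤ ‖k‖) (hβ : |β| ≤ ‖k‖) :
    |Real.cos (u + α + β) * ((1 + dispersion k - Real.sqrt (dispersion k * (dispersion k + 2))) ^ n /
          Real.sqrt (dispersion k * (dispersion k + 2))) -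
        Real.cos (u + α) * ((1 + dispersion k - Real.sqrt (dispersion k * (dispersion k + 2))) ^ n /
          Real.sqrt (dispersion k * (dispersion k + 2))) -
        Real.cos (u + β) * ((1 + dispersion k - Real.sqrt (dispersion k * (dispersion k + 2))) ^ n /
          Real.sqrt (dispersion k * (dispersion k + 2))) +
        Real.cos u * ((1 + dispersion k - Real.sqrt (dispersion k * (dispersion k + 2))) ^ n /
          Real.sqrt (dispersion k * (dispersion k + 2)))| ≤
      π / 2 * (‖k‖ * (1 + dispersion k - Real.sqrt (dispersion k * (dispersion k + 2))) ^ n) := by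
  set R : ℝ := 1 + dispersion k - Real.sqrt (dispersion k * (dispersion k + 2)) with hR
  set S : ℝ := Real.sqrt (dispersion k * (dispersion k + 2)) with hS
  have hfac : Real.cos (u + α + β) * (R ^ n / S) - Real.cos (u + α) * (R ^ n / S) - Real.cos (u + β) * (R ^ n / S) +
      Real.cos u * (R ^ n / S) = (Real.cos (u + α + β) - Real.cos (u + α) - Real.cos (u + β) + Real.cos u) * (R ^ n / S) := by
    ring
  rw [hfac, abs_mul]
  have hRn : 0 ≤ R ^ n := pow_nonneg (ratio_pos (dispersion_nonneg k)).le n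
  have hq : 0 ≤ R ^ n / S := div_nonneg hRn (Real.sqrt_nonneg _)
  rw [abs_of_nonneg hq]
  have h2 : |Real.cos (u + α + β) - Real.cos (u + α) - Real.cos (u + β) + Real.cos u| ≤ ‖k‖ * ‖k‖ :=
    (abs_cos_second_diff_le u α β).trans (mul_le_mul hα hβ (abs_nonneg _) (norm_nonneg _))
  have h3 := norm_mul_div_sqrt_le hk hk0 hRn
  calc |Real.cos (u + α + β) - Real.cos (u + α) - Real.cos (u + β) + Real.cos u| * (R ^ n / S)
      ≤ ‖k‖ * ‖k‖ * (R ^ n / S) := mul_le_mul_of_nonneg_right h2 hq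
    _ = ‖k‖ * (‖k‖ * (R ^ n / S)) := by ring
    _ ≤ ‖k‖ * (π / 2 * R ^ n) := mul_le_mul_of_nonneg_left h3 (norm_nonneg _)
    _ = π / 2 * (‖k‖ * R ^ n) := by ring

/-- Pattern `s0` (one spatial, one temporal difference): `|Δ_α cos(u) · Δ₀(rⁿ)/√(ε(ε+2))| ≤ ‖k‖ rⁿ`. -/
theorem pw_s0 (k : Fin 3 → ℝ) (n : ℕ) (u : ℝ) {α : ℝ} (hα : |α| ≤ ‖k‖) :
    |Real.cos (u + α) * ((1 + dispersion k - Real.sqrt (dispersion k * (dispersion k + 2))) ^ (n + 1) /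
          Real.sqrt (dispersion k * (dispersion k + 2))) -
        Real.cos (u + α) * ((1 + dispersion k - Real.sqrt (dispersion k * (dispersion k + 2))) ^ n /
          Real.sqrt (dispersion k * (dispersion k + 2))) -
        Real.cos u * ((1 + dispersion k - Real.sqrt (dispersion k * (dispersion k + 2))) ^ (n + 1) /
          Real.sqrt (dispersion k * (dispersion k + 2))) +
        Real.cos u * ((1 + dispersion k - Real.sqrt (dispersion k * (dispersion k + 2))) ^ n /
          Real.sqrt (dispersion k * (dispersion k + 2)))| ≤
      1 * (‖k‖ * (1 + dispersion k - Real.sqrt (dispersion k * (dispersion k + 2))) ^ n) := by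
  set R : ℝ := 1 + dispersion k - Real.sqrt (dispersion k * (dispersion k + 2)) with hR
  set S : ℝ := Real.sqrt (dispersion k * (dispersion k + 2)) with hS
  have hfac : Real.cos (u + α) * (R ^ (n + 1) / S) - Real.cos (u + α) * (R ^ n / S) - Real.cos u * (R ^ (n + 1) / S) +
      Real.cos u * (R ^ n / S) = -((Real.cos (u + α) - Real.cos u) * ((1 - R) * (R ^ n / S))) := by
    ring
  rw [hfac, abs_neg, abs_mul]
  have hRn : 0 ≤ R ^ n := pow_nonneg (ratio_pos (dispersion_nonneg k)).le n
  have h1R : 0 ≤ 1 - R := one_sub_ratio_nonneg (dispersion_nonneg k)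
  have hq : 0 ≤ (1 - R) * (R ^ n / S) := mul_nonneg h1R (div_nonneg hRn (Real.sqrt_nonneg _))
  rw [abs_of_nonneg hq]
  have ht := (abs_cos_add_sub_cos_le u α).trans hα
  have h3 := one_sub_ratio_mul_div_sqrt_le k hRn
  calc |Real.cos (u + α) - Real.cos u| * ((1 - R) * (R ^ n / S))
      ≤ ‖k‖ * ((1 - R) * (R ^ n / S)) := mul_le_mul_of_nonneg_right ht hq
    _ ≤ ‖k‖ * R ^ n := mul_le_mul_of_nonneg_left h3 (norm_nonneg _)
    _ = 1 * (‖k‖ * R ^ n) := by ring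

/-- Pattern `0ss` (temporal difference of two spatial differences): bound `‖k‖² rⁿ`. -/
theorem pw_0ss (k : Fin 3 → ℝ) (n : ℕ) (u : ℝ) {α β : ℝ} (hα : |α| ≤ ‖k‖) (hβ : |β| ≤ ‖k‖) :
    |(Real.cos (u + α + β) * ((1 + dispersion k - Real.sqrt (dispersion k * (dispersion k + 2))) ^ (n + 1) /
          Real.sqrt (dispersion k * (dispersion k + 2))) -
        Real.cos (u + α) * ((1 + dispersion k - Real.sqrt (dispersion k * (dispersion k + 2))) ^ (n + 1) /
          Real.sqrt (dispersion k * (dispersion k + 2))) -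
        Real.cos (u + β) * ((1 + dispersion k - Real.sqrt (dispersion k * (dispersion k + 2))) ^ (n + 1) /
          Real.sqrt (dispersion k * (dispersion k + 2))) +
        Real.cos u * ((1 + dispersion k - Real.sqrt (dispersion k * (dispersion k + 2))) ^ (n + 1) /
          Real.sqrt (dispersion k * (dispersion k + 2)))) -
      (Real.cos (u + α + β) * ((1 + dispersion k - Real.sqrt (dispersion k * (dispersion k + 2))) ^ n /
          Real.sqrt (dispersion k * (dispersion k + 2))) -
        Real.cos (u + α) * ((1 + dispersion k - Real.sqrt (dispersion k * (dispersion k + 2))) ^ n /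
          Real.sqrt (dispersion k * (dispersion k + 2))) -
        Real.cos (u + β) * ((1 + dispersion k - Real.sqrt (dispersion k * (dispersion k + 2))) ^ n /
          Real.sqrt (dispersion k * (dispersion k + 2))) +
        Real.cos u * ((1 + dispersion k - Real.sqrt (dispersion k * (dispersion k + 2))) ^ n /
          Real.sqrt (dispersion k * (dispersion k + 2))))| ≤
      1 * (‖k‖ ^ 2 * (1 + dispersion k - Real.sqrt (dispersion k * (dispersion k + 2))) ^ n) := by
  set R : ℝ := 1 + dispersion k - Real.sqrt (dispersion k * (dispersion k + 2)) with hR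
  set S : ℝ := Real.sqrt (dispersion k * (dispersion k + 2)) with hS
  have hfac : Real.cos (u + α + β) * (R ^ (n + 1) / S) - Real.cos (u + α) * (R ^ (n + 1) / S) -
        Real.cos (u + β) * (R ^ (n + 1) / S) + Real.cos u * (R ^ (n + 1) / S) -
      (Real.cos (u + α + β) * (R ^ n / S) - Real.cos (u + α) * (R ^ n / S) - Real.cos (u + β) * (R ^ n / S) +
        Real.cos u * (R ^ n / S)) =
      -((Real.cos (u + α + β) - Real.cos (u + α) - Real.cos (u + β) + Real.cos u) * ((1 - R) * (R ^ n / S))) := by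
    ring
  rw [hfac, abs_neg, abs_mul]
  have hRn : 0 ≤ R ^ n := pow_nonneg (ratio_pos (dispersion_nonneg k)).le n
  have h1R : 0 ≤ 1 - R := one_sub_ratio_nonneg (dispersion_nonneg k)
  have hq : 0 ≤ (1 - R) * (R ^ n / S) := mul_nonneg h1R (div_nonneg hRn (Real.sqrt_nonneg _))
  rw [abs_of_nonneg hq]
  have h2 : |Real.cos (u + α + β) - Real.cos (u + α) - Real.cos (u + β) + Real.cos u| ≤ ‖k‖ * ‖k‖ :=
    (abs_cos_second_diff_le u α β).trans (mul_le_mul hα hβ (abs_nonneg _) (norm_nonneg _))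
  have h3 := one_sub_ratio_mul_div_sqrt_le k hRn
  calc |Real.cos (u + α + β) - Real.cos (u + α) - Real.cos (u + β) + Real.cos u| * ((1 - R) * (R ^ n / S))
      ≤ ‖k‖ * ‖k‖ * ((1 - R) * (R ^ n / S)) := mul_le_mul_of_nonneg_right h2 hq
    _ ≤ ‖k‖ * ‖k‖ * R ^ n := mul_le_mul_of_nonneg_left h3 (by positivity)
    _ = 1 * (‖k‖ ^ 2 * R ^ n) := by ring

/-- Pattern `00s` (second temporal difference of one spatial difference): bound `7 ‖k‖² rⁿ` on the zone. -/
theorem pw_00s (hk : k ∈ brillouin 3) (n : ℕ) (u : ℝ) {α : ℝ} (hα : |α| ≤ ‖k‖) :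
    |(Real.cos (u + α) * ((1 + dispersion k - Real.sqrt (dispersion k * (dispersion k + 2))) ^ (n + 2) /
          Real.sqrt (dispersion k * (dispersion k + 2))) -
        Real.cos (u + α) * ((1 + dispersion k - Real.sqrt (dispersion k * (dispersion k + 2))) ^ (n + 1) /
          Real.sqrt (dispersion k * (dispersion k + 2))) -
        Real.cos u * ((1 + dispersion k - Real.sqrt (dispersion k * (dispersion k + 2))) ^ (n + 2) /
          Real.sqrt (dispersion k * (dispersion k + 2))) +
        Real.cos u * ((1 + dispersion k - Real.sqrt (dispersion k * (dispersion k + 2))) ^ (n + 1) /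
          Real.sqrt (dispersion k * (dispersion k + 2)))) -
      (Real.cos (u + α) * ((1 + dispersion k - Real.sqrt (dispersion k * (dispersion k + 2))) ^ (n + 1) /
          Real.sqrt (dispersion k * (dispersion k + 2))) -
        Real.cos (u + α) * ((1 + dispersion k - Real.sqrt (dispersion k * (dispersion k + 2))) ^ n /
          Real.sqrt (dispersion k * (dispersion k + 2))) -
        Real.cos u * ((1 + dispersion k - Real.sqrt (dispersion k * (dispersion k + 2))) ^ (n + 1) /
          Real.sqrt (dispersion k * (dispersion k + 2))) +
        Real.cos u * ((1 + dispersion k - Real.sqrt (dispersion k * (dispersion k + 2))) ^ n /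
          Real.sqrt (dispersion k * (dispersion k + 2))))| ≤
      7 * (‖k‖ ^ 2 * (1 + dispersion k - Real.sqrt (dispersion k * (dispersion k + 2))) ^ n) := by
  set R : ℝ := 1 + dispersion k - Real.sqrt (dispersion k * (dispersion k + 2)) with hR
  set S : ℝ := Real.sqrt (dispersion k * (dispersion k + 2)) with hS
  have hfac : Real.cos (u + α) * (R ^ (n + 2) / S) - Real.cos (u + α) * (R ^ (n + 1) / S) -
        Real.cos u * (R ^ (n + 2) / S) + Real.cos u * (R ^ (n + 1) / S) -
      (Real.cos (u + α) * (R ^ (n + 1) / S) - Real.cos (u + α) * (R ^ n / S) - Real.cos u * (R ^ (n + 1) / S) +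
        Real.cos u * (R ^ n / S)) =
      (Real.cos (u + α) - Real.cos u) * ((1 - R) * ((1 - R) * (R ^ n / S))) := by
    ring
  rw [hfac, abs_mul]
  have hRn : 0 ≤ R ^ n := pow_nonneg (ratio_pos (dispersion_nonneg k)).le n
  have h1R : 0 ≤ 1 - R := one_sub_ratio_nonneg (dispersion_nonneg k)
  have hq0 : 0 ≤ (1 - R) * (R ^ n / S) := mul_nonneg h1R (div_nonneg hRn (Real.sqrt_nonneg _))
  have hq : 0 ≤ (1 - R) * ((1 - R) * (R ^ n / S)) := mul_nonneg h1R hq0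
  rw [abs_of_nonneg hq]
  have ht := (abs_cos_add_sub_cos_le u α).trans hα
  have h3 := one_sub_ratio_mul_div_sqrt_le k hRn
  have h4 : 1 - R ≤ 7 * ‖k‖ := (one_sub_ratio_le_sqrt (dispersion_nonneg k)).trans (sqrt_le_norm hk)
  calc |Real.cos (u + α) - Real.cos u| * ((1 - R) * ((1 - R) * (R ^ n / S)))
      ≤ ‖k‖ * ((1 - R) * ((1 - R) * (R ^ n / S))) := mul_le_mul_of_nonneg_right ht hq
    _ ≤ ‖k‖ * ((7 * ‖k‖) * R ^ n) := by
        refine mul_le_mul_of_nonneg_left ?_ (norm_nonneg _)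
        exact mul_le_mul h4 h3 hq0 (by positivity)
    _ = 7 * (‖k‖ ^ 2 * R ^ n) := by ring

end Patterns

end GreenDecay

end Summit.QuantumFields.YangMills.Theorems.HankelDensitySplitting.LogWindow

end
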